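import Summits.BirchSwinnertonDyer.BirchSwinnertonDyer.Theorems.KatoDescentPotSupersingularKummerKernelOrthogonal
import Literature.NumberTheory.EllipticCurves.LocalKummerIsotropyTransport
import Literature.NumberTheory.EllipticCurves.WeilPairingTateDual
import HarnessLib

/-!
# The Tate dual `i^D : M₂^D → M₁^D` of an equivariant map `i : M₁ → M₂` is ADJOINT to `i` under the local Tate pairings,
# `⟨a, (i^D)_* b⟩_v = ⟨i_* a, b⟩_v`; and for the level inclusion `E[d] ↪ E[kd]`: `(incl)^D ∘ w_{kd} = desc^♭ ∘ [k]` on `H¹`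
# (route `KatoDescentPotSupersingular` / `…Tame…`, crux M = stmt-BirchSwinnertonDyer-19196; route-free helper)

Seat `bsd-potss-rkm` g19 (prover; cell `bsd-potss`), item stmt-BirchSwinnertonDyer-19196 (`--supports … --as helper`; closes
nothing).  HONEST FRAMING: BSD is not proved by any of this; nothing is booked; theorems only (no definition, no named fact):
TOOL theorems of local Galois cohomology.

## Why (companion (ii) of brick (a) of crux M's level-0 ledger — memo `HOME/rkm/FINDING-19196-rkm-g19.md` §"What remains", steps P3/P4)

The Poitou–Tate COKERNEL bound `#coker(S(E[p^∞]) → ⊕_{ℓ≠p} H¹_ur(ℚ_ℓ,E[p^∞])) ≤ #E(ℚ)/p^K` is proved at two finite levels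
`K ≤ K' = K + s`: `SelmerComplement` is applied at level `p^{K'}` to the LEVEL-TRANSPORTED local datum `i_* t` (`i : E[p^K] ↪ E[p^{K'}]`), and
the global classes of the dual Selmer group of `E[p^{K'}]^D` are brought back to level `K` through the Tate dual `i^D`.  Two facts about
`i^D` are needed and proved here:

* §1 (any finite discrete modules `M₁ → M₂` over a number field, any `N`, any place `v`, any additive `inv_v`) the Tate dual of `i` is the
  dual map `(i^D f)(x) = f(i x)` of the equivariant `μ_N`-valued pairing `(x, f) ↦ f(i x)` (the tree's `pairingDualIntertwining`; NO new
  definition), equivariant by `tateDualEval_comp_smul`; **`localTatePairingZMod_map_tateDual_comp`: `⟨a, (i^D)_* b⟩_v = ⟨i_* a, b⟩_v`**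
  on local classes (part 35's L1-translation + `ContPairing.cupProduct_adjoint`).
* §2 (elliptic `W` over a field `F` of characteristic `0`, levels `d`, `kd`, a level-`kd` Weil datum `e` with Weil transport `w_{kd} : E[kd] → E[kd]^D`
  and DESCENDED pairing `desc : E[d] × E[d] → μ_{kd}`): `(incl_{d,kd})^D ∘ w_{kd} = desc^♭ ∘ [k]` pointwise (`tateDual_incl_weilDual_eq_descend_mulK`,
  = the tree's `descendHom_apply_eq`), hence on `H¹` over `F` and over any extension field `E/F`:
  **`map_inclDual_map_weilDual_eq_map_descendDual_map_mulK[_restrictField]`** — the dual-side level transport IS multiplication by `k`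
  read through the Weil transports.  With `k = p^s` killing `Ш[p^∞]` this turns dual Selmer classes of level `K'` into KUMMER classes of
  `E(ℚ)` at level `K` (part 42).

References: J. S. Milne, *ADT* I §0 (`M ↦ M^D`), Cor. 2.3, §6 proof of Prop. 6.9 [MilneADT2006]; J. H. Silverman, *AEC* III.8.1 (e)
[SilvermanAEC2009]; Neukirch–Schmidt–Wingberg, *CNF* I §4 (1.4.2) [NeukirchSchmidtWingberg2008].
-/

-- the summit and its single problem are both named `BirchSwinnertonDyer` (registry layout D-0017)
set_option linter.dupNamespace false
set_option autoImplicit false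

noncomputable section

open scoped Classical ContRepresentation NumberField
open CategoryTheory Function Field NumberField IsDedekindDomain WeierstrassCurve
open Literature.NumberTheory.GaloisRepresentations Literature.NumberTheory.EllipticCurves
open Literature.NumberTheory.GaloisRepresentations.DiscreteGaloisModule (mu MuCarrier pairing TateDual tateDual tateDualEval
  tateDualPairingLocal localTatePairing localTatePairingZMod homOfIntertwining)

universe u

namespace Summit.BirchSwinnertonDyer.BirchSwinnertonDyer.Theorems.KummerTowerOrthogonal

/-! ## §1 The Tate dual of an equivariant map and its adjointness under the local Tate pairings -/

section TateDualMap

variable {K : Type u} [Field K]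
variable {M₁ : Type u} [AddCommGroup M₁] [TopologicalSpace M₁] [DiscreteTopology M₁] [Finite M₁]
variable {M₂ : Type u} [AddCommGroup M₂] [TopologicalSpace M₂] [DiscreteTopology M₂] [Finite M₂]
variable {ρ₁ : DiscreteGaloisModule K M₁} {ρ₂ : DiscreteGaloisModule K M₂} (N : ℕ)
variable (i : ρ₁.toContRepresentation →ⁱL ρ₂.toContRepresentation)

omit [Finite M₁] in
/-- **The pairing `(x, f) ↦ f(i x) : M₁ × M₂^D → μ_N` is `Γ_K`-equivariant** for an equivariant `i : M₁ → M₂` (so that its dual map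
`pairingDualIntertwining`, `f ↦ f ∘ i`, is THE Tate dual `i^D : M₂^D → M₁^D` as an intertwining map). [cite: MilneADT2006, I §0] -/
theorem tateDualEval_comp_smul (σ : absoluteGaloisGroup K) (x : M₁) (f : TateDual K M₂ N) :
    ((tateDualEval K M₂ N).comp i.toContinuousLinearMap.toLinearMap.toAddMonoidHom) (ρ₁ σ x) (ρ₂.tateDual N σ f) =
      mu K N σ (((tateDualEval K M₂ N).comp i.toContinuousLinearMap.toLinearMap.toAddMonoidHom) x f) := by
  have hi : i (ρ₁ σ x) = ρ₂ σ (i x) := by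
    have h := i.isIntertwining σ x
    rwa [ContinuousRep.toContRepresentation_apply_apply, ContinuousRep.toContRepresentation_apply_apply] at h
  change tateDualEval K M₂ N (i (ρ₁ σ x)) (ρ₂.tateDual N σ f) = mu K N σ (tateDualEval K M₂ N (i x) f)
  rw [hi]
  exact DiscreteGaloisModule.tateDualEval_smul ρ₂ N σ (i x) f

/-- Unfolding the Tate dual: `(i^D f)(x) = f (i x)`. [cite: MilneADT2006, I §0] -/
theorem pairingDualIntertwining_tateDualEval_comp_apply (f : TateDual K M₂ N) (x : M₁) :
    DiscreteGaloisModule.pairingDualIntertwining (tateDualEval_comp_smul N i) f x = f (i x) :=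
  rfl

variable [NumberField K]

/-- **Adjointness of `i` and `i^D` under the local Tate pairings: `⟨a, (i^D)_* b⟩_v = ⟨i_* a, b⟩_v`** for local classes
`a ∈ H¹(K_v, M₁)`, `b ∈ H¹(K_v, M₂^D)`, any place `v`, any additive `inv_v : H²(K_v, μ_N) → ℤ/N` — both sides are `inv_v` of the cup product
of `a` and `b` for the pairing `(x,f) ↦ f(i x)` (part 35's L1-translation on the left, `ContPairing.cupProduct_adjoint` on the right).
[cite: MilneADT2006, Ch. I §0 and Cor. 2.3] [cite: NeukirchSchmidtWingberg2008, I §4 (1.4.2)] -/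
theorem localTatePairingZMod_map_tateDual_comp (v : Place K) (inv : galoisCohomology ((mu K N).toLocal v) 2 →+ ZMod N)
    (a : galoisCohomology (ρ₁.toLocal v) 1) (b : galoisCohomology ((ρ₂.tateDual N).toLocal v) 1) :
    localTatePairingZMod ρ₁ N v inv a
        (galoisCohomology.map ((DiscreteGaloisModule.pairingDualIntertwining (tateDualEval_comp_smul N i)).restrictField
          (Place.Completion v)) 1 b) =
      localTatePairingZMod ρ₂ N v inv (galoisCohomology.map (i.restrictField (Place.Completion v)) 1 a) b := by
  haveI : CharZero (Place.Completion v) := charZero_placeCompletion (K := K) v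
  rw [localTatePairingZMod_map_pairingDualIntertwining, DiscreteGaloisModule.localTatePairingZMod_apply]
  congr 1
  -- `(i_* a) ∪_{ev} b = a ∪_{ev ∘ i} b`
  have h := ContPairing.cupProduct_adjoint
    (pairing (ρ₁.toLocal v) ((ρ₂.tateDual N).toLocal v) ((mu K N).toLocal v)
      ((tateDualEval K M₂ N).comp i.toContinuousLinearMap.toLinearMap.toAddMonoidHom)
      (fun σ x y => tateDualEval_comp_smul N i (absGaloisRestrict K (Place.Completion v) σ) x y))
    (tateDualPairingLocal ρ₂ N v) (homOfIntertwining (i.restrictField (Place.Completion v))) (𝟙 _) (fun _ _ => rfl) a b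
  have h1 : (cohomologyMap (𝟙 ((ρ₂.tateDual N).toLocal v).toTopRep) 1) b = b := by
    rw [show cohomologyMap (𝟙 ((ρ₂.tateDual N).toLocal v).toTopRep) 1 = 𝟙 _ from map_id_eq_id _ (fun _ => rfl) 1]
    rfl
  rw [h1] at h
  exact h.symm

end TateDualMap

/-! ## §2 For the level inclusion `E[d] ↪ E[kd]`: `(incl)^D ∘ w_{kd} = desc^♭ ∘ [k]` on `H¹` -/

section Weil

variable {F : Type u} [Field F] [CharZero F] (W : WeierstrassCurve F) [W.IsElliptic] (k d : ℕ) [NeZero k] [NeZero d]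
  (e : geomTorsion W ((k * d : ℕ) : ℤ) → geomTorsion W ((k * d : ℕ) : ℤ) → AlgebraicClosure F)
  (hμ : ∀ S T, e S T ^ (k * d) = 1)
  (hadd₁ : ∀ S₁ S₂ T, e (S₁ + S₂) T = e S₁ T * e S₂ T)
  (hadd₂ : ∀ S T₁ T₂, e S (T₁ + T₂) = e S T₁ * e S T₂)
  (hgal : ∀ (σ : absoluteGaloisGroup F) (S T : geomTorsion W ((k * d : ℕ) : ℤ)), σ • e S T = e (σ • S) (σ • T))
  [Finite (geomTorsion W ((k * d : ℕ) : ℤ))] [Finite (geomTorsion W (d : ℤ))]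

/-- **`(incl)^D (w_{kd} S') = desc^♭ ([k] S')`** in `E[d]^D = Hom(E[d], μ_{kd})` for every `S' ∈ E[kd]`: both send `S ∈ E[d]` to `e_{kd}(ι S, S')`
(`descendHom_apply_eq`: `desc(S, [k]S') = e(ιS, S')`). [cite: SilvermanAEC2009, Prop. III.8.1 (e)] -/
theorem tateDual_incl_weilDual_eq_descend_mulK (S' : geomTorsion W ((k * d : ℕ) : ℤ)) :
    DiscreteGaloisModule.pairingDualIntertwining (tateDualEval_comp_smul (k * d) (inclKD W k d))
        (weilDualIntertwining W (k * d) e hμ hadd₁ hadd₂ hgal S') =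
      DiscreteGaloisModule.pairingDualIntertwining
        (ρ₁ := W.torsionGaloisModule (d : ℤ)) (ρ₂ := W.torsionGaloisModule (d : ℤ))
        (B := descendHom W k d e hμ hadd₁ hadd₂) (descendHom_smul W k d e hμ hadd₁ hadd₂ hgal) (mulK W k d S') := by
  refine DiscreteGaloisModule.TateDual.ext fun S => ?_
  change weilDualIntertwining W (k * d) e hμ hadd₁ hadd₂ hgal S' (inclKD W k d S) = descendHom W k d e hμ hadd₁ hadd₂ S (mulK W k d S')
  rw [weilDualIntertwining_apply, weilDualHom_apply_apply, descendHom_apply_eq W k d e hμ hadd₁ hadd₂ S (mulK W k d S') S' rfl]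

/-- **On `H¹(F, ·)`: `(incl)^D_* (w_{kd})_* c = (desc^♭)_* ([k]_* c)`** for every `c ∈ H¹(F, E[kd])` (cocycle-level, from the pointwise
identity). [cite: SilvermanAEC2009, Prop. III.8.1 (e)] [cite: MilneADT2006, Ch. I §6, proof of Prop. 6.9] -/
theorem map_inclDual_map_weilDual_eq_map_descendDual_map_mulK
    (c : galoisCohomology (W.torsionGaloisModule ((k * d : ℕ) : ℤ)) 1) :
    galoisCohomology.map (DiscreteGaloisModule.pairingDualIntertwining (tateDualEval_comp_smul (k * d) (inclKD W k d))) 1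
        (galoisCohomology.map (weilDualIntertwining W (k * d) e hμ hadd₁ hadd₂ hgal) 1 c) =
      galoisCohomology.map (DiscreteGaloisModule.pairingDualIntertwining
        (ρ₁ := W.torsionGaloisModule (d : ℤ)) (ρ₂ := W.torsionGaloisModule (d : ℤ))
        (B := descendHom W k d e hμ hadd₁ hadd₂) (descendHom_smul W k d e hμ hadd₁ hadd₂ hgal)) 1
        (galoisCohomology.map (mulK W k d) 1 c) := by
  obtain ⟨φ, rfl⟩ := oneCocycleClass_surjective _ c
  rw [galoisCohomology.map_one_oneCocycleClass, galoisCohomology.map_one_oneCocycleClass,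
    galoisCohomology.map_one_oneCocycleClass, galoisCohomology.map_one_oneCocycleClass]
  refine congrArg _ (Subtype.ext (ContinuousMap.ext fun g ↦ ?_))
  exact tateDual_incl_weilDual_eq_descend_mulK W k d e hμ hadd₁ hadd₂ hgal (φ.1 g)

/-- **The same over any extension field `E/F` of characteristic `0`** (e.g. a completion; the maps restricted to `Γ_E`).
[cite: SilvermanAEC2009, Prop. III.8.1 (e)] [cite: MilneADT2006, Ch. I §6, proof of Prop. 6.9] -/
theorem map_inclDual_map_weilDual_eq_map_descendDual_map_mulK_restrictField (E : Type u) [Field E] [Algebra F E]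
    (c : galoisCohomology (GaloisRep.restrictField E (W.torsionGaloisModule ((k * d : ℕ) : ℤ))) 1) :
    galoisCohomology.map ((DiscreteGaloisModule.pairingDualIntertwining
        (tateDualEval_comp_smul (k * d) (inclKD W k d))).restrictField E) 1
        (galoisCohomology.map ((weilDualIntertwining W (k * d) e hμ hadd₁ hadd₂ hgal).restrictField E) 1 c) =
      galoisCohomology.map ((DiscreteGaloisModule.pairingDualIntertwining
        (ρ₁ := W.torsionGaloisModule (d : ℤ)) (ρ₂ := W.torsionGaloisModule (d : ℤ))
        (B := descendHom W k d e hμ hadd₁ hadd₂) (descendHom_smul W k d e hμ hadd₁ hadd₂ hgal)).restrictField E) 1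
        (galoisCohomology.map ((mulK W k d).restrictField E) 1 c) := by
  obtain ⟨φ, rfl⟩ := oneCocycleClass_surjective _ c
  rw [galoisCohomology.map_one_oneCocycleClass, galoisCohomology.map_one_oneCocycleClass,
    galoisCohomology.map_one_oneCocycleClass, galoisCohomology.map_one_oneCocycleClass]
  refine congrArg _ (Subtype.ext (ContinuousMap.ext fun g ↦ ?_))
  exact tateDual_incl_weilDual_eq_descend_mulK W k d e hμ hadd₁ hadd₂ hgal (φ.1 g)

end Weil

end Summit.BirchSwinnertonDyer.BirchSwinnertonDyer.Theorems.KummerTowerOrthogonal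

end
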